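import Summits.CriticalPhenomena.PercolationContinuityZ3.Theorems.PercNearOneGluingNoHeavyLowerTailFrontierDecRowsClusterMarkov
import Literature.Probability.Percolation.TwoSetExchange
import HarnessLib

/-!
# Sahi's `E₃ ≥ 0` for `(D[c|P∪Q], D[P|Q], D[c|Y])` on EVERY finite weighted graph — the free-vertex split criterion;
# four-point frontier row 33 `(D[ab|c], D[a|b], D[c|y])` for all `n`

Support file (prover prim-l12-p1 gen 3, P1 line; `--supports stmt-CriticalPhenomena-4575`).  No definitions, no named facts, no
sorries, no `native_decide`.  New mathematics (not in print); the percolation input is van den Berg–Häggström–Kahn 2006 Thm 2.1 at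
`q = 1` in its tree form `Literature.Probability.Percolation.setTwoClusterExchange` (two-SET exchange), plus the conditional-Harris
reduction of Sahi's functional (`prodBernoulli_sahiE3_nonneg_of_condHarris_lower`).

THEOREM (`sahiE3_sepFree_sep_free_nonneg`).  Bernoulli bond percolation, arbitrary edge weights, finite vertex type; vertex sets
`P, Q, Y`, a vertex `c`, `M = D[P|Q] = {P ↮ Q}`, `A = D[P∪Q | c] = {c ↮ P ∪ Q}`, `C = D[c|Y]`.  Then
  (i)  `μ(M ∩ A) · μ(M ∩ C) ≤ μ(M) · μ(M ∩ A ∩ C)`   (given `{P ↮ Q}`, the events "`c` is free of `P ∪ Q`" and "`c ↮ Y`" are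
       positively correlated — `sepFree_free_posCorrelation`), and hence
  (ii) `E₃(A, M, C) ≥ 0`.
With `P = {a}, Q = {b}, Y = {y}` this is row 33 `(D[ab|c], D[a|b], D[c|y])` of `…FrontierDecRowsLeFive` for EVERY `n`
(`FrontierDecRows.frontier_33_all`), one of the eight four-point decreasing cubic orbits left open by the cluster-Markov criterion of
`…FrontierDecRowsClusterMarkovCore/…ClusterMarkov/…ClusterMarkovKill` (prim-l12-p1 gen 2); seven remain (rows 12, 15, 27, 30, 36, 37, 44).

PROOF of (i) (split `M` by the side `c` attaches to).  On `M`, `c` is joined to `P`, or to `Q`, or to neither (not both: `P ↮ Q`):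
`M = (M ∩ A) ⊔ M_P ⊔ M_Q`, `M_P = M ∩ {c ~ P}`.  With `D_Q = {P ∪ {c} ↮ Q}` one has `M_P = D_Q ∩ {c ~ P}` and `M ∩ A = D_Q ∩ {c ↮ P}`,
and for the pair `(S, T) = (P ∪ {c}, Q)` the event `{c ~ P} = ⋃_{p ∈ P} {c ↔ p}` is of type `(+)` while `C = ⋂_{y∈Y} {c ↮ y}` is of type `(−)`
(`c ∈ S`); BHK Thm 2.1 (exchange form) gives `μ(D_Q)·μ(D_Q ∩ {c~P} ∩ C) ≤ μ(D_Q ∩ {c~P})·μ(D_Q ∩ C)`, i.e.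
`μ(M∩A)·μ(M_P ∩ C) ≤ μ(M_P)·μ(M∩A∩C)` ("`c ↮ Y` is less likely when `c` hangs on `P` than when `c` is free").  The same with `P, Q`
exchanged; summing the two and adding `μ(M∩A)μ(M∩A∩C)` to both sides gives (i).  (ii) is (i) + three Harris steps
(`prodBernoulli_sahiE3_nonneg_of_condHarris_lower`).
-/

noncomputable section

namespace Summit.CriticalPhenomena.PercolationContinuityZ3.Theorems

namespace FreeVertexSplitE3

open MeasureTheory Literature.Probability.Percolation Literature.Probability.LatticeModels
open TwoSetExchange ClusterMarkovE3
open scoped Classical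

variable {V : Type*} [Fintype V]

omit [Fintype V] in
/-- Membership in `openConn` is reachability in the open graph. [folklore] -/
theorem mem_openConn_iff (ω : BondConfig V) (u v : V) :
    ω ∈ (openConn u v : Set (BondConfig V)) ↔ (openGraph ω).Reachable u v := Iff.rfl

/-- **One side.**  For `(S, T) = (P ∪ {c}, Q)`, `D = {S ↮ T}`, `F = {c ~ P}` (type `(+)`) and `C = {c ↮ Y}` (type `(−)`):
`μ(D ∩ Fᶜ) · μ(D ∩ F ∩ C) ≤ μ(D ∩ F) · μ(D ∩ Fᶜ ∩ C)` — BHK Thm 2.1 (negative correlation of opposite types given `D`) rearranged.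
[this work] -/
theorem side (w : Sym2 V → unitInterval) (P Q Y : Set V) (c : V) :
    (prodBernoulli w).real ({ω : BondConfig V | ∀ s ∈ P ∪ {c}, ∀ t ∈ Q, ¬ (openGraph ω).Reachable s t} ∩
        {ω | ∀ p ∈ P, ¬ (openGraph ω).Reachable c p}) *
      (prodBernoulli w).real ({ω : BondConfig V | ∀ s ∈ P ∪ {c}, ∀ t ∈ Q, ¬ (openGraph ω).Reachable s t} ∩
        {ω | ∃ p ∈ P, (openGraph ω).Reachable c p} ∩ {ω | ∀ y ∈ Y, ¬ (openGraph ω).Reachable c y}) ≤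
    (prodBernoulli w).real ({ω : BondConfig V | ∀ s ∈ P ∪ {c}, ∀ t ∈ Q, ¬ (openGraph ω).Reachable s t} ∩
        {ω | ∃ p ∈ P, (openGraph ω).Reachable c p}) *
      (prodBernoulli w).real ({ω : BondConfig V | ∀ s ∈ P ∪ {c}, ∀ t ∈ Q, ¬ (openGraph ω).Reachable s t} ∩
        {ω | ∀ p ∈ P, ¬ (openGraph ω).Reachable c p} ∩ {ω | ∀ y ∈ Y, ¬ (openGraph ω).Reachable c y}) := by
  classical
  set D : Set (BondConfig V) := {ω | ∀ s ∈ P ∪ {c}, ∀ t ∈ Q, ¬ (openGraph ω).Reachable s t} with hD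
  set F : Set (BondConfig V) := {ω | ∃ p ∈ P, (openGraph ω).Reachable c p} with hF
  set C : Set (BondConfig V) := {ω | ∀ y ∈ Y, ¬ (openGraph ω).Reachable c y} with hC
  have hFc : {ω : BondConfig V | ∀ p ∈ P, ¬ (openGraph ω).Reachable c p} = Fᶜ := by
    ext ω; simp [hF]
  rw [hFc]
  have hc : c ∈ P ∪ {c} := Set.mem_union_right P (Set.mem_singleton c)
  -- the generators: `F = ⋃_p {c ↔ p}` is of type (+), `C = ⋂_y {c ↔ y}ᶜ` of type (−) for `(P ∪ {c}, Q)`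
  have hFeq : F = ⋃ p ∈ P, (openConn c p : Set (BondConfig V)) := by
    ext ω; simp [hF, mem_openConn_iff]
  have hCeq : C = ⋂ y ∈ Y, (openConn c y : Set (BondConfig V))ᶜ := by
    ext ω; simp [hC, mem_openConn_iff]
  have key := setTwoClusterExchange w (P ∪ {c}) Q (A₁ := F) (A₂ := Set.univ) (B₁ := C) (B₂ := Set.univ)
    (by
      intro ω ω' h1 h2 hω
      rw [hFeq] at hω ⊢
      obtain ⟨p, hp, hωp⟩ := Set.mem_iUnion₂.1 hω
      exact Set.mem_iUnion₂.2 ⟨p, hp, typePlus_openConn_of_mem (P ∪ {c}) Q hc p h1 h2 hωp⟩)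
    (fun _ _ _ _ _ => Set.mem_univ _)
    (by
      intro ω ω' h1 h2 hω
      rw [hCeq] at hω ⊢
      exact Set.mem_iInter₂.2 fun y hy => typeMinus_not_openConn_of_mem (P ∪ {c}) Q hc y h1 h2 (Set.mem_iInter₂.1 hω y hy))
    (fun _ _ _ _ _ => Set.mem_univ _)
  simp only [Set.inter_univ] at key
  -- key : μ(D ∩ (F ∩ C)) * μ(D) ≤ μ(D ∩ F) * μ(D ∩ C)
  have hsplitD : (prodBernoulli w).real (D ∩ F) + (prodBernoulli w).real (D ∩ Fᶜ) = (prodBernoulli w).real D := by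
    rw [← Set.sdiff_eq]; exact measureReal_inter_add_sdiff MeasurableSet.of_discrete
  have hsplitDC : (prodBernoulli w).real (D ∩ C ∩ F) + (prodBernoulli w).real (D ∩ C ∩ Fᶜ) =
      (prodBernoulli w).real (D ∩ C) := by
    rw [← Set.sdiff_eq]; exact measureReal_inter_add_sdiff MeasurableSet.of_discrete
  have e1 : D ∩ (F ∩ C) = D ∩ F ∩ C := (Set.inter_assoc _ _ _).symm
  have e2 : D ∩ C ∩ F = D ∩ F ∩ C := by rw [Set.inter_assoc, Set.inter_comm C F, ← Set.inter_assoc]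
  have e3 : D ∩ C ∩ Fᶜ = D ∩ Fᶜ ∩ C := by rw [Set.inter_assoc, Set.inter_comm C Fᶜ, ← Set.inter_assoc]
  rw [e1] at key
  rw [e2, e3] at hsplitDC
  have h0 : 0 ≤ (prodBernoulli w).real (D ∩ F ∩ C) := measureReal_nonneg
  have h1 : 0 ≤ (prodBernoulli w).real (D ∩ F) := measureReal_nonneg
  nlinarith [key, hsplitD, hsplitDC, h0, h1]

/-- **(i) Conditional positive correlation.**  Given `{P ↮ Q}`, the events `{c ↮ P ∪ Q}` ("`c` free") and `{c ↮ Y}` are positively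
correlated: `μ(M ∩ A)·μ(M ∩ C) ≤ μ(M)·μ(M ∩ (A ∩ C))`. [this work] -/
theorem sepFree_free_posCorrelation (w : Sym2 V → unitInterval) (P Q Y : Set V) (c : V) :
    (prodBernoulli w).real ({ω : BondConfig V | ∀ p ∈ P, ∀ q ∈ Q, ¬ (openGraph ω).Reachable p q} ∩
        {ω | ∀ q ∈ P ∪ Q, ¬ (openGraph ω).Reachable c q}) *
      (prodBernoulli w).real ({ω : BondConfig V | ∀ p ∈ P, ∀ q ∈ Q, ¬ (openGraph ω).Reachable p q} ∩
        {ω | ∀ y ∈ Y, ¬ (openGraph ω).Reachable c y}) ≤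
    (prodBernoulli w).real {ω : BondConfig V | ∀ p ∈ P, ∀ q ∈ Q, ¬ (openGraph ω).Reachable p q} *
      (prodBernoulli w).real ({ω : BondConfig V | ∀ p ∈ P, ∀ q ∈ Q, ¬ (openGraph ω).Reachable p q} ∩
        ({ω | ∀ q ∈ P ∪ Q, ¬ (openGraph ω).Reachable c q} ∩ {ω | ∀ y ∈ Y, ¬ (openGraph ω).Reachable c y})) := by
  classical
  set μ := prodBernoulli w with hμ
  set M : Set (BondConfig V) := {ω | ∀ p ∈ P, ∀ q ∈ Q, ¬ (openGraph ω).Reachable p q} with hM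
  set A : Set (BondConfig V) := {ω | ∀ q ∈ P ∪ Q, ¬ (openGraph ω).Reachable c q} with hA
  set C : Set (BondConfig V) := {ω | ∀ y ∈ Y, ¬ (openGraph ω).Reachable c y} with hC
  set FP : Set (BondConfig V) := {ω | ∃ p ∈ P, (openGraph ω).Reachable c p} with hFP
  set FQ : Set (BondConfig V) := {ω | ∃ q ∈ Q, (openGraph ω).Reachable c q} with hFQ
  set DQ : Set (BondConfig V) := {ω | ∀ s ∈ P ∪ {c}, ∀ t ∈ Q, ¬ (openGraph ω).Reachable s t} with hDQ
  set DP : Set (BondConfig V) := {ω | ∀ s ∈ Q ∪ {c}, ∀ t ∈ P, ¬ (openGraph ω).Reachable s t} with hDP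
  -- the set identities behind the split `M = (M ∩ A) ⊔ (M ∩ FP) ⊔ (M ∩ FQ)`
  have iNP : DQ ∩ {ω | ∀ p ∈ P, ¬ (openGraph ω).Reachable c p} = M ∩ A := by
    ext ω
    simp only [hDQ, hM, hA, Set.mem_inter_iff, Set.mem_setOf_eq, Set.mem_union, Set.mem_singleton_iff]
    constructor
    · rintro ⟨h1, h2⟩
      refine ⟨fun p hp q hq => h1 p (Or.inl hp) q hq, fun q hq => ?_⟩
      rcases hq with hq | hq
      · exact h2 q hq
      · exact h1 c (Or.inr rfl) q hq
    · rintro ⟨h1, h2⟩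
      refine ⟨fun s hs t ht => ?_, fun p hp => h2 p (Or.inl hp)⟩
      rcases hs with hs | rfl
      · exact h1 s hs t ht
      · exact h2 t (Or.inr ht)
  have iNQ : DP ∩ {ω | ∀ q ∈ Q, ¬ (openGraph ω).Reachable c q} = M ∩ A := by
    ext ω
    simp only [hDP, hM, hA, Set.mem_inter_iff, Set.mem_setOf_eq, Set.mem_union, Set.mem_singleton_iff]
    constructor
    · rintro ⟨h1, h2⟩
      refine ⟨fun p hp q hq hr => h1 q (Or.inl hq) p hp hr.symm, fun q hq => ?_⟩
      rcases hq with hq | hq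
      · exact h1 c (Or.inr rfl) q hq
      · exact h2 q hq
    · rintro ⟨h1, h2⟩
      refine ⟨fun s hs t ht => ?_, fun q hq => h2 q (Or.inr hq)⟩
      rcases hs with hs | rfl
      · exact fun hr => h1 t ht s hs hr.symm
      · exact h2 t (Or.inl ht)
  have iFP : DQ ∩ FP = M ∩ FP := by
    ext ω
    simp only [hDQ, hM, hFP, Set.mem_inter_iff, Set.mem_setOf_eq, Set.mem_union, Set.mem_singleton_iff]
    constructor
    · rintro ⟨h1, h2⟩
      exact ⟨fun p hp q hq => h1 p (Or.inl hp) q hq, h2⟩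
    · rintro ⟨h1, p, hp, hcp⟩
      refine ⟨fun s hs t ht => ?_, p, hp, hcp⟩
      rcases hs with hs | rfl
      · exact h1 s hs t ht
      · exact fun hct => h1 p hp t ht (hcp.symm.trans hct)
  have iFQ : DP ∩ FQ = M ∩ FQ := by
    ext ω
    simp only [hDP, hM, hFQ, Set.mem_inter_iff, Set.mem_setOf_eq, Set.mem_union, Set.mem_singleton_iff]
    constructor
    · rintro ⟨h1, h2⟩
      exact ⟨fun p hp q hq hr => h1 q (Or.inl hq) p hp hr.symm, h2⟩
    · rintro ⟨h1, q, hq, hcq⟩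
      refine ⟨fun s hs t ht => ?_, q, hq, hcq⟩
      rcases hs with hs | rfl
      · exact fun hr => h1 t ht s hs hr.symm
      · exact fun hct => h1 t ht q hq (hct.symm.trans hcq)
  -- the two one-sided inequalities
  have sP := side w P Q Y c
  have sQ := side w Q P Y c
  rw [iNP, iFP] at sP
  rw [iNQ, iFQ] at sQ
  -- additivity: for any event `E`, `μ(M ∩ E) = μ(M ∩ A ∩ E) + μ(M ∩ FP ∩ E) + μ(M ∩ FQ ∩ E)`
  have split : ∀ E : Set (BondConfig V),
      μ.real (M ∩ E) = μ.real (M ∩ A ∩ E) + μ.real (M ∩ FP ∩ E) + μ.real (M ∩ FQ ∩ E) := by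
    intro E
    have hdisj1 : Disjoint (M ∩ A ∩ E) (M ∩ FP ∩ E) := by
      rw [Set.disjoint_left]
      rintro ω ⟨⟨-, hA'⟩, -⟩ ⟨⟨-, p, hp, hcp⟩, -⟩
      exact hA' p (Or.inl hp) hcp
    have hdisj2 : Disjoint (M ∩ A ∩ E ∪ M ∩ FP ∩ E) (M ∩ FQ ∩ E) := by
      rw [Set.disjoint_left]
      rintro ω hω ⟨⟨hM', q, hq, hcq⟩, -⟩
      rcases hω with ⟨⟨-, hA'⟩, -⟩ | ⟨⟨-, p, hp, hcp⟩, -⟩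
      · exact hA' q (Or.inr hq) hcq
      · exact hM' p hp q hq (hcp.symm.trans hcq)
    have hunion : M ∩ E = (M ∩ A ∩ E ∪ M ∩ FP ∩ E) ∪ M ∩ FQ ∩ E := by
      ext ω
      simp only [Set.mem_inter_iff, Set.mem_union, hA, hFP, hFQ, Set.mem_setOf_eq, Set.mem_union]
      constructor
      · rintro ⟨hM', hE⟩
        by_cases h : ∀ q ∈ P ∪ Q, ¬ (openGraph ω).Reachable c q
        · exact Or.inl (Or.inl ⟨⟨hM', h⟩, hE⟩)
        · push Not at h
          obtain ⟨q, hq, hcq⟩ := h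
          rcases hq with hq | hq
          · exact Or.inl (Or.inr ⟨⟨hM', q, hq, hcq⟩, hE⟩)
          · exact Or.inr ⟨⟨hM', q, hq, hcq⟩, hE⟩
      · rintro ((⟨⟨hM', -⟩, hE⟩ | ⟨⟨hM', -⟩, hE⟩) | ⟨⟨hM', -⟩, hE⟩) <;> exact ⟨hM', hE⟩
    rw [hunion, measureReal_union hdisj2 MeasurableSet.of_discrete, measureReal_union hdisj1 MeasurableSet.of_discrete]
  have sM := split Set.univ
  have sC := split C
  simp only [Set.inter_univ] at sM
  have eAC : M ∩ (A ∩ C) = M ∩ A ∩ C := (Set.inter_assoc _ _ _).symm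
  rw [eAC, sM, sC]
  have n1 : 0 ≤ μ.real (M ∩ A) := measureReal_nonneg
  have n2 : 0 ≤ μ.real (M ∩ A ∩ C) := measureReal_nonneg
  have n3 : 0 ≤ μ.real (M ∩ FP) := measureReal_nonneg
  have n4 : 0 ≤ μ.real (M ∩ FQ) := measureReal_nonneg
  nlinarith [sP, sQ, n1, n2, n3, n4]

/-- **(ii) THEOREM (free-vertex split criterion).**  `0 ≤ E₃(D[P∪Q | c], D[P|Q], D[c|Y])` on every finite weighted graph, for all
vertex sets `P, Q, R, Y` with `R = P ∪ Q` (membership form) and every vertex `c`. [this work] -/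
theorem sahiE3_sepFree_sep_free_nonneg (w : Sym2 V → unitInterval) (P Q R Y : Set V) (c : V)
    (hR : ∀ v, v ∈ R ↔ v ∈ P ∨ v ∈ Q) :
    0 ≤ sahiE3 (prodBernoulli w) {ω : BondConfig V | ∀ p ∈ R, ∀ q ∈ ({c} : Set V), ¬ (openGraph ω).Reachable p q}
      {ω : BondConfig V | ∀ p ∈ P, ∀ q ∈ Q, ¬ (openGraph ω).Reachable p q}
      {ω : BondConfig V | ∀ p ∈ ({c} : Set V), ∀ q ∈ Y, ¬ (openGraph ω).Reachable p q} := by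
  classical
  have hAeq : {ω : BondConfig V | ∀ p ∈ R, ∀ q ∈ ({c} : Set V), ¬ (openGraph ω).Reachable p q} =
      {ω | ∀ q ∈ P ∪ Q, ¬ (openGraph ω).Reachable c q} := by
    ext ω
    simp only [Set.mem_setOf_eq, Set.mem_singleton_iff, forall_eq, Set.mem_union]
    constructor
    · intro h q hq hr; exact h q ((hR q).2 hq) hr.symm
    · intro h p hp hr; exact h p ((hR p).1 hp) hr.symm
  have hCeq : {ω : BondConfig V | ∀ p ∈ ({c} : Set V), ∀ q ∈ Y, ¬ (openGraph ω).Reachable p q} =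
      {ω | ∀ y ∈ Y, ¬ (openGraph ω).Reachable c y} := by
    ext ω; simp
  rw [hAeq, hCeq, sahiE3_comm₂₃]
  have hA : IsLowerSet {ω : BondConfig V | ∀ q ∈ P ∪ Q, ¬ (openGraph ω).Reachable c q} := by
    rw [← sepEv_singleton]; exact isLowerSet_sepEv _ _
  have hC : IsLowerSet {ω : BondConfig V | ∀ y ∈ Y, ¬ (openGraph ω).Reachable c y} := by
    rw [← sepEv_singleton]; exact isLowerSet_sepEv _ _
  refine prodBernoulli_sahiE3_nonneg_of_condHarris_lower w hA hC (isLowerSet_sepEv P Q)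
    MeasurableSet.of_discrete MeasurableSet.of_discrete MeasurableSet.of_discrete ?_
  have h := sepFree_free_posCorrelation w P Q Y c
  rw [Set.inter_comm _ {ω : BondConfig V | ∀ q ∈ P ∪ Q, ¬ (openGraph ω).Reachable c q},
    Set.inter_comm _ {ω : BondConfig V | ∀ y ∈ Y, ¬ (openGraph ω).Reachable c y},
    Set.inter_comm _ ({ω : BondConfig V | ∀ q ∈ P ∪ Q, ¬ (openGraph ω).Reachable c q} ∩
      {ω : BondConfig V | ∀ y ∈ Y, ¬ (openGraph ω).Reachable c y})] at h
  exact h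

end FreeVertexSplitE3

namespace FrontierDecRows

open MeasureTheory CovTransferCert E3GroupSepCert HybridRows ClusterMarkovE3 FreeVertexSplitE3
open Literature.Probability.Percolation Literature.Probability.LatticeModels

variable {n : ℕ}

/-- **Row `33` = `(D[ab|c], D[a|b], D[c|y])` on EVERY finite weighted graph** (free-vertex split criterion: middle `{a ↮ b}`, free vertex
`c`; all `n`, all weights, all `a b c y`, no distinctness). [this work] -/
theorem frontier_33_all (w : Sym2 (Fin n) → unitInterval) (a b c y : Fin n) :
    0 ≤ sahiE3 (prodBernoulli w) (connEvent (row 33 n (a, b, c, y)).1) (connEvent (row 33 n (a, b, c, y)).2.1)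
      (connEvent (row 33 n (a, b, c, y)).2.2) := by
  have hr : row 33 n (a, b, c, y) = (sep [a, b] [c], sep [a] [b], sep [c] [y]) := rfl
  rw [hr]
  rw [connEvent_sep_eq_setOf [a, b] [c], connEvent_sep_eq_setOf [a] [b], connEvent_sep_eq_setOf [c] [y]]
  have hc : ({v | v ∈ [c]} : Set (Fin n)) = {c} := by ext v; simp
  rw [hc]
  exact sahiE3_sepFree_sep_free_nonneg w {v | v ∈ [a]} {v | v ∈ [b]} {v | v ∈ [a, b]} {v | v ∈ [y]} c
    (fun v => by simp)

/-- Row `33` in term form, all `n`. [this work] -/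
theorem frontier_33_cval_all (w : Sym2 (Fin n) → unitInterval) (a b c y : Fin n) : 0 ≤ cval w (terms 33 n (a, b, c, y)) :=
  cval_terms_nonneg_of_sahiE3 33 w a b c y (frontier_33_all w a b c y)

end FrontierDecRows

end Summit.CriticalPhenomena.PercolationContinuityZ3.Theorems
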